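import Mathlib
import HarnessLib
import Summits.HubbardSuperconductivity.HubbardSuperconductivity.Theorems.KLProgrammeC4aChordMidpointDepthPerturbative

/-!
# Route `KLProgramme` — crux C4a, (U1) «(T)-MARGIN-PERTURBATIVE» part 2c: the direct-sheet exclusion with an EXPLICIT MODULUS and NO numeric door (the closer trades the
# frame-shift size `A` against the margin continuously; door-free on the lower part of the window)

Cell `gate-hubbard-kl`, seat hubbard-kl-k3c3-p3 (g35; row «implicit-function / monotonicity route for μ(n)»).  Helper for stub (C) `stub_twoLeg_curvature` of
`KLRegimeEngineV17F2` (stmt-HubbardSuperconductivity-20437); pen (R383) «(T)-MARGIN-A»; memo HOME/hubbard-kl-k3c3-p3/U1-CAUSTIC-SUP.md §18.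

`…C4aDirectSheetExclusion` fixes the flat door `A ≤ 1/200` to get the modulus `1/1000` uniformly on the window.  The perturbative depth lemma itself
(`frameLevel_midpoint_pairSum_le_perturbative`) has the modulus `κ(A,c) = c/(6π²) − A/8 − A²/(4c)`, `c = −μ − A − |ρ|`, which is POSITIVE under the standing `hA20 : A ≤ 1/20`
alone as soon as `c ≳ 0.46` (e.g. `1/400` for `c ≥ 3/5`: `perturbativeModulus_ge_of_le`; the lower half of the window), and in general whenever the consumer's `A` is small against `c`.  This file states the chord bound
and the exclusion row for ANY positive `κ ≤ κ(A,c)` supplied by the consumer: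
* **`norm_chord_sq_le_of_midpoint_near_modulus`**: `0 < κ ≤ κ(A, −μ−A−|ρ|)`, `‖S − 2Φ(0,χ)‖ ≤ ε` ⟹ `‖Φ(0,θ) − Φ(ρ,ϑ+θ)‖² ≤ (|ρ|/2 + ρ²/(4(−μ−A−|ρ|)) + K_cε/2)/κ`;
* **`directSheet_excluded_of_modulus`**: with the margin `(|ρ|/2 + ρ²/(4(−μ−A−|ρ|)) + K_cτ₀/2)/κ < ((2u_min/π)ϑ_T)²` (`0 ≤ ϑ_T`): `∀ ϑ, ϑ_T ≤ ‖ϑ‖_𝕋 → ∀ χ, τ₀ < ‖S(ϑ) − 2Φ(0,χ)‖`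
  — the `hT0` row of the margin-free (U1) arc theorems, no numeric door.
Elementary; nothing asserts (C), K3, the window or superconductivity.
References: FST II CPAM 51 (1998) §3 (H3) [cite: FeldmanSalmhoferTrubowitz1998]; BGM 2003 §7.1 [cite: BenfattoGiulianiMastropietro2003].
-/

noncomputable section

namespace Summit.HubbardSuperconductivity.HubbardSuperconductivity.Theorems.C4a

set_option linter.dupNamespace false -- summit = problem name (single-conjunct summit), D-0017

open Real Set
open Literature.MathematicalPhysics.QuantumLattice Literature.MathematicalPhysics.QuantumLattice.BandSectorCounting
open Literature.MathematicalPhysics.QuantumLattice.FermiRG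
open Summit.HubbardSuperconductivity.HubbardSuperconductivity.Theorems.KLRegimeSplit
open Summit.HubbardSuperconductivity.HubbardSuperconductivity.Theorems.DispersionFlow
open Summit.HubbardSuperconductivity.HubbardSuperconductivity.Theorems.PerturbedFermiCurve

section Sizes

variable {K : TrigPolyC4v} {A : ℝ} (hA : ∀ p : Momentum, ∀ j ≤ 2, ‖iteratedFDeriv ℝ j (frameShift K) p‖ ≤ A)
  {μ r : ℝ} (hr : 0 < r) (hlo : (-1.1 : ℝ) < μ - r - A) (hhi : μ + r + A < -0.1)
include hA hr hlo hhi

/-- **Short chord from a near-curve midpoint, explicit modulus**: for any `0 < κ ≤ (−μ−A−|ρ|)/(6π²) − A/8 − A²/(4(−μ−A−|ρ|))`, `‖S − 2Φ(0,χ)‖ ≤ ε` ⟹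
`‖Φ(0,θ) − Φ(ρ,ϑ+θ)‖² ≤ (|ρ|/2 + ρ²/(4(−μ−A−|ρ|)) + K_c·ε/2)/κ` — no numeric door. [cite: FeldmanSalmhoferTrubowitz1998, §3 (H3)] -/
theorem norm_chord_sq_le_of_midpoint_near_modulus {Kc r₀ g₀ w : ℝ} (hG : GeomConstants (frameLevel μ K) Kc r₀ g₀ w) {ρ : ℝ} (hρ : |ρ| < r) {κ : ℝ}
    (hκ0 : 0 < κ) (hκ : κ ≤ (-μ - A - |ρ|) / (6 * π ^ 2) - A / 8 - A ^ 2 / (4 * (-μ - A - |ρ|))) {ϑ θ χ ε : ℝ}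
    (hε : ‖pairSumPath μ K ρ ϑ θ 0 - (2 : ℝ) • levelPoint μ K 0 χ‖ ≤ ε) :
    ‖levelPoint μ K 0 θ - levelPoint μ K ρ (ϑ + θ)‖ ^ 2 ≤ (|ρ| / 2 + ρ ^ 2 / (4 * (-μ - A - |ρ|)) + Kc * ε / 2) / κ := by
  set B := bandBounds (show (-4 : ℝ) < -1.1 by norm_num) (show (-1.1 : ℝ) ≤ -0.1 by norm_num) (show (-0.1 : ℝ) < 0 by norm_num) with hBdef
  have hρ1 := (abs_lt.1 hρ).1; have hρ2 := (abs_lt.1 hρ).2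
  have hρabs : |ρ| < r := hρ
  have hlo₀ : (-1.1 : ℝ) ≤ μ + 0 - A := by linarith
  have hhi₀ : μ + 0 + A ≤ -0.1 := by linarith
  have hloρ : (-1.1 : ℝ) ≤ μ + ρ - A := by linarith
  have hhiρ : μ + ρ + A ≤ -0.1 := by linarith
  have hneg : μ + A + |ρ| < 0 := by linarith
  have hdepth := frameLevel_midpoint_pairSum_le_perturbative B hA hlo₀ hhi₀ hloρ hhiρ hneg ϑ θ
  -- Lipschitz from the curve point `Φ(0,χ)` (`e_K = 0` there)
  have hzero : frameLevel μ K (levelPoint μ K 0 χ) = 0 := frameLevel_levelPoint_zero B hA hr hlo hhi χ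
  have hS : pairSumPath μ K ρ ϑ θ 0 = levelPoint μ K 0 θ + levelPoint μ K ρ (ϑ + θ) := by simp only [pairSumPath, add_zero]
  set M : Momentum := (1 / 2 : ℝ) • (levelPoint μ K 0 θ + levelPoint μ K ρ (ϑ + θ)) with hMdef
  have hMQ : ‖M - levelPoint μ K 0 χ‖ ≤ ε / 2 := by
    have e : M - levelPoint μ K 0 χ = (1 / 2 : ℝ) • (pairSumPath μ K ρ ϑ θ 0 - (2 : ℝ) • levelPoint μ K 0 χ) := by
      rw [hMdef, hS]; module
    rw [e, norm_smul, Real.norm_eq_abs, abs_of_pos (by norm_num : (0 : ℝ) < 1 / 2)]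
    linarith
  have hlip := PerturbedFermiCurve.abs_frameLevel_sub_le hG (levelPoint μ K 0 χ) M
  rw [hzero, sub_zero] at hlip
  have hKc : 0 ≤ Kc := le_trans (norm_nonneg _) (hG.norm_iteratedFDeriv_le (0 : Momentum) 0 (by norm_num))
  have hlow : -(Kc * ε / 2) ≤ frameLevel μ K M := by
    have h1 := (abs_le.1 hlip).1
    have h2 : Kc * ‖M - levelPoint μ K 0 χ‖ ≤ Kc * (ε / 2) := mul_le_mul_of_nonneg_left hMQ hKc
    linarith
  -- the modulus
  set L := ‖levelPoint μ K 0 θ - levelPoint μ K ρ (ϑ + θ)‖ ^ 2 with hLdef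
  have hL0 : 0 ≤ L := sq_nonneg _
  have hkey : ((-μ - A - |ρ|) / (6 * π ^ 2) - A / 8 - A ^ 2 / (4 * (-μ - A - |ρ|))) * L ≤
      |ρ| / 2 + ρ ^ 2 / (4 * (-μ - A - |ρ|)) + Kc * ε / 2 := by
    have := le_abs_self ρ; linarith
  have hκL : κ * L ≤ |ρ| / 2 + ρ ^ 2 / (4 * (-μ - A - |ρ|)) + Kc * ε / 2 := (mul_le_mul_of_nonneg_right hκ hL0).trans hkey
  rw [le_div_iff₀ hκ0]; linarith

/-- **NO DIRECT-SHEET CAUSTIC OFF THE TANGENCY MARGIN — explicit modulus, no numeric door**: for any `0 < κ ≤ (−μ−A−|ρ|)/(6π²) − A/8 − A²/(4(−μ−A−|ρ|))` and the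
margin `(|ρ|/2 + ρ²/(4(−μ−A−|ρ|)) + K_cτ₀/2)/κ < ((2u_min/π)ϑ_T)²` (`0 ≤ ϑ_T`): `∀ ϑ, ϑ_T ≤ ‖ϑ‖_𝕋 → ∀ χ, τ₀ < ‖S_{ρ,ϑ,θ} − 2Φ(0,χ)‖`. -/
theorem directSheet_excluded_of_modulus {Kc r₀ g₀ w : ℝ} (hG : GeomConstants (frameLevel μ K) Kc r₀ g₀ w) {ρ : ℝ} (hρ : |ρ| < r) (θ : ℝ) {κ : ℝ}
    (hκ0 : 0 < κ) (hκ : κ ≤ (-μ - A - |ρ|) / (6 * π ^ 2) - A / 8 - A ^ 2 / (4 * (-μ - A - |ρ|))) {τ₀ ϑT : ℝ} (hϑT0 : 0 ≤ ϑT)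
    (hϑT : (|ρ| / 2 + ρ ^ 2 / (4 * (-μ - A - |ρ|)) + Kc * τ₀ / 2) / κ <
      (2 * (bandBounds (show (-4 : ℝ) < -1.1 by norm_num) (show (-1.1 : ℝ) ≤ -0.1 by norm_num) (show (-0.1 : ℝ) < 0 by norm_num)).umin / π * ϑT) ^ 2) :
    ∀ ϑ : ℝ, ϑT ≤ torusDist ϑ → ∀ χ : ℝ, τ₀ < ‖pairSumPath μ K ρ ϑ θ 0 - (2 : ℝ) • levelPoint μ K 0 χ‖ := by
  intro ϑ hϑ χ
  by_contra hle
  push Not at hle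
  have hupos : 0 < 2 * (bandBounds (show (-4 : ℝ) < -1.1 by norm_num) (show (-1.1 : ℝ) ≤ -0.1 by norm_num) (show (-0.1 : ℝ) < 0 by norm_num)).umin / π := by
    have := (bandBounds (show (-4 : ℝ) < -1.1 by norm_num) (show (-1.1 : ℝ) ≤ -0.1 by norm_num) (show (-0.1 : ℝ) < 0 by norm_num)).umin_pos
    positivity
  have h1 := norm_chord_sq_le_of_midpoint_near_modulus hA hr hlo hhi hG hρ hκ0 hκ hle
  have h2 := torusDist_le_norm_chord hA hlo hhi hρ ϑ θ
  have h3 : (2 * (bandBounds (show (-4 : ℝ) < -1.1 by norm_num) (show (-1.1 : ℝ) ≤ -0.1 by norm_num) (show (-0.1 : ℝ) < 0 by norm_num)).umin / π *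
      torusDist ϑ) ^ 2 ≤ ‖levelPoint μ K 0 θ - levelPoint μ K ρ (ϑ + θ)‖ ^ 2 :=
    pow_le_pow_left₀ (mul_nonneg hupos.le (norm_nonneg _)) h2 2
  have h4 : (2 * (bandBounds (show (-4 : ℝ) < -1.1 by norm_num) (show (-1.1 : ℝ) ≤ -0.1 by norm_num) (show (-0.1 : ℝ) < 0 by norm_num)).umin / π * ϑT) ^ 2 ≤
      (2 * (bandBounds (show (-4 : ℝ) < -1.1 by norm_num) (show (-1.1 : ℝ) ≤ -0.1 by norm_num) (show (-0.1 : ℝ) < 0 by norm_num)).umin / π *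
        torusDist ϑ) ^ 2 :=
    pow_le_pow_left₀ (mul_nonneg hupos.le hϑT0) (mul_le_mul_of_nonneg_left hϑ hupos.le) 2
  linarith

omit hA hr hlo hhi in
/-- **The explicit modulus is positive under the standing door `A ≤ 1/20` on the lower part of the window**: `0 ≤ A ≤ 1/20`, `3/5 ≤ c` ⟹
`1/400 ≤ c/(6π²) − A/8 − A²/(4c)` — there (`−μ ≥ 3/5 + A + |ρ|`) the perturbative margin needs NO extra door. -/
theorem perturbativeModulus_ge_of_le {c : ℝ} (hA0 : 0 ≤ A) (hA20 : A ≤ 1 / 20) (hc : 3 / 5 ≤ c) :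
    1 / 400 ≤ c / (6 * π ^ 2) - A / 8 - A ^ 2 / (4 * c) := by
  have hπ := Real.pi_lt_d4
  have hπ0 := Real.pi_pos
  have hsq : π ^ 2 < 3.1416 ^ 2 := pow_lt_pow_left₀ hπ hπ0.le two_ne_zero
  have hπsq : 6 * π ^ 2 < 2961 / 50 := by norm_num at hsq ⊢; linarith
  have hc0 : 0 < c := by linarith
  have h1 : c / (2961 / 50) ≤ c / (6 * π ^ 2) := div_le_div_of_nonneg_left hc0.le (by positivity) hπsq.le
  have h2 : A ^ 2 ≤ 1 / 400 := by nlinarith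
  have h3 : A ^ 2 / (4 * c) ≤ 1 / 960 := by rw [div_le_iff₀ (by positivity)]; nlinarith
  have h4 : (3 / 5 : ℝ) / (2961 / 50) ≤ c / (2961 / 50) := div_le_div_of_nonneg_right hc (by norm_num)
  have h5 : (1 : ℝ) / 400 + 1 / 160 + 1 / 960 ≤ (3 / 5 : ℝ) / (2961 / 50) := by norm_num
  linarith

end Sizes

end Summit.HubbardSuperconductivity.HubbardSuperconductivity.Theorems.C4a

end
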